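import Mathlib
import Literature.AlgebraicGeometry.Resolution.CurveChartTransportIndexed
import HarnessLib

/-!
# The polygon under the blowing up of the curve `V(y, u₁)`, ARBITRARY embedding dimension: translation by one unit to the left

Topic: `Literature/AlgebraicGeometry/Resolution`. Dimension-general form of the laws half of `CurveBlowupPolygonLaws.lean` (`c : Fin 3 → R`):
eleventh brick of the generalisation `Fin 3 → Fin (r+2)` of the tree's expansion-free rendering of Hironaka's characteristic polyhedra (memo
`run/shared/lean/pub/res-hironaka/L/res-L1-w42-stub-3/KEYCLAIM-PORT-PLAN.md` §4–§5). Cossart–Jannsen–Saito, LNM 2270, **Lemma 12.4 (4)** /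
Cossart–Piltant 2008 Lemma 4.5 (1): for the blowing up along `C = V(y₁, …, y_r, u₁)` (permissible for `(J, μ)`: `J ⊆ (y, u₁)^μ`), at the point
`x′` with parameters `(y′_j = y_j/u₁, u₁, u₂)`, the weak transform `J′ = (J R′ : u₁^μ)` has `Δ(J′) = Δ(J) − (1, 0)`: `α′ = α − 1`, `β′ = β`
(«translated by one unit to the left»), and `ε′ = ε`, `ζ′ ≤ ζ − 1`. For the SCALED invariants of `PolygonInvariantsIndexed` in the curve-chart
setting of `CurveChartTransportIndexed`; statements and proofs of the `Fin 3` file verbatim.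

* `levelWeight_eq_curvePullbackWeight`, `forall_pts_colon_curve_of_forall_pts`, `lowerBound_pts_colon_curve`,
  `alphaS_le_spt₁_colon_curve_add`, `betaS_le_spt₂_colon_curve`, `exists_pts_colon_curve_v`, `pts_colon_curve_nonempty`;
* **laws** `alphaS_colon_curve_add` (`αs′ + L = αs`), `betaS_colon_curve_eq` (`βs′ = βs`), `exists_pts_colon_curve_zeta`, `epsS_le_spt₂_colon_curve`,
  `epsS_colon_curve_eq` (`εs′ = εs`), `zetaS_colon_curve_add_le` (`ζs′ + L ≤ ζs`).

Sources: V. Cossart, U. Jannsen, S. Saito, LNM **2270** (2020), Lemma 12.4 (4) [`CossartJannsenSaito2020`]; V. Cossart, O. Piltant, J. Algebra 320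
(2008), Lemma 4.5 (1), p. 11 [`CossartPiltant2008`]. No named facts; no instance, notation or attribute.
-/

noncomputable section

open IsLocalRing MvPolynomial

namespace Literature.AlgebraicGeometry.Resolution

namespace WeightedOrder

universe u

section Laws

variable {R R' : Type u} [CommRing R] [CommRing R'] (φ : R →+* R') {r : ℕ} {c : Fin (r + 2) → R}
  {c' : Fin (r + 2) → R'} (hcy : ∀ i : Fin r, φ (c (Fin.castAdd 2 i)) = φ (c (u1 r)) * c' (Fin.castAdd 2 i))
  (hc1 : c' (u1 r) = φ (c (u1 r))) (hc2 : c' (u2 r) = φ (c (u2 r)))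
  [IsRegularLocalRing R] [IsRegularLocalRing R']
  (hgen : Ideal.span (Set.range c) = maximalIdeal R) (hdim : ringKrullDim R = r + 2)
  (hgen' : Ideal.span (Set.range c') = maximalIdeal R') (hdim' : ringKrullDim R' = r + 2)
  {J : Ideal R} {μ : ℕ}

/-- The curve pull-back of a level weight: `(w₀′ + L p₁′, L p₁′, L p₂′)`. [cite: CossartJannsenSaito2020, Lemma 12.4 (4)] -/
theorem levelWeight_eq_curvePullbackWeight (μ w₀' p₁' p₂' : ℕ) :
    levelWeight (r := r) μ (w₀' + μ.factorial * p₁') p₁' p₂' = curvePullbackWeight (levelWeight μ w₀' p₁' p₂') := by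
  funext i
  by_cases h1i : i = u1 r
  · subst h1i; rw [curvePullbackWeight_u1, levelWeight_u1, levelWeight_u1]
  by_cases h2i : i = u2 r
  · subst h2i; rw [curvePullbackWeight_u2, levelWeight_u2, levelWeight_u2]
  · have hi : curvePullbackWeight (levelWeight μ w₀' p₁' p₂') i = levelWeight μ w₀' p₁' p₂' i + levelWeight μ w₀' p₁' p₂' (u1 r) := by
      simp [curvePullbackWeight, h1i, h2i]
    rw [hi, levelWeight_u1]
    revert h1i h2i
    refine Fin.addCases (fun k _ _ => ?_) (fun k hk1 hk2 => ?_) i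
    · rw [levelWeight_y, levelWeight_y]
    · fin_cases k
      · exact absurd rfl hk1
      · exact absurd rfl hk2

include hcy hc1 hc2 hgen hdim hgen' hdim' in
/-- **Transport of half-planes** (curve chart): if all points of `pts c J μ` satisfy
`p₁′ (x₁ − L) + p₂′ x₂ ≥ w₀′` then all points of `pts c′ J′ μ` satisfy `p₁′ x₁ + p₂′ x₂ ≥ w₀′`
(`w₀′, p₁′, p₂′ > 0`). [cite: CossartJannsenSaito2020, Lemma 12.4 (4)] -/
theorem forall_pts_colon_curve_of_forall_pts {w₀' p₁' p₂' : ℕ} (hw₀' : 0 < w₀') (hp₁' : 0 < p₁')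
    (hp₂' : 0 < p₂')
    (hS : ∀ e ∈ pts c J μ, w₀' + μ.factorial * p₁' ≤ p₁' * spt₁ μ e + p₂' * spt₂ μ e) :
    ∀ e' ∈ pts c' ((J.map φ).colon {φ (c (u1 r)) ^ μ}) μ, w₀' ≤ p₁' * spt₁ μ e' + p₂' * spt₂ μ e' := by
  have hJ : J ≤ weightedOrderIdeal c (levelWeight μ (w₀' + μ.factorial * p₁') p₁' p₂')
      ((w₀' + μ.factorial * p₁') * μ) :=
    (le_weightedOrderIdeal_levelWeight_iff c hgen hdim J (by omega) hp₁' hp₂').mpr hS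
  rw [levelWeight_eq_curvePullbackWeight] at hJ
  have hlev : (w₀' + μ.factorial * p₁') * μ = w₀' * μ + μ * (levelWeight μ w₀' p₁' p₂' (u1 r)) := by
    rw [levelWeight_u1]; ring
  rw [hlev] at hJ
  have hW' := levelWeight_pos (r := r) (μ := μ) hw₀' hp₁' hp₂'
  have hJ' := colon_le_weightedOrderIdeal_of_le_curve φ hcy hc1 hc2 _ hgen' hdim' hW' hJ
  exact (le_weightedOrderIdeal_levelWeight_iff c' hgen' hdim' _ hw₀' hp₁' hp₂').mp hJ'

include hcy hc1 hc2 hgen hdim hgen' hdim' in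
/-- Lower bound `N x₁′ + x₂′ ≥ N (αs − L) + βs` for the points of the weak transform, for all
`N ≥ βs + 1` (`L < δs`, `L ≤ αs`). [cite: CossartJannsenSaito2020, Lemma 12.4 (4)] -/
theorem lowerBound_pts_colon_curve (hne : (pts c J μ).Nonempty) (hδ : μ.factorial < deltaS c J μ)
    (hα : μ.factorial ≤ alphaS c J μ) {N : ℕ} (hN : betaS c J μ + 1 ≤ N) :
    ∀ e' ∈ pts c' ((J.map φ).colon {φ (c (u1 r)) ^ μ}) μ, N * (alphaS c J μ - μ.factorial) + betaS c J μ ≤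
      N * spt₁ μ e' + 1 * spt₂ μ e' := by
  have hpos : 0 < N * (alphaS c J μ - μ.factorial) + betaS c J μ := by
    have hd := deltaS_le_alphaS_add_betaS hne
    rcases hα.eq_or_lt with hαeq | hαlt
    · rw [← hαeq, Nat.sub_self, mul_zero, zero_add]; omega
    · have h1' : 1 ≤ alphaS c J μ - μ.factorial := by omega
      have : 1 * 1 ≤ N * (alphaS c J μ - μ.factorial) := Nat.mul_le_mul (by omega) h1'
      omega
  refine forall_pts_colon_curve_of_forall_pts φ hcy hc1 hc2 hgen hdim hgen' hdim' hpos
    (by omega) Nat.one_pos fun e he => ?_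
  have hkey : N * (alphaS c J μ - μ.factorial) + μ.factorial * N = N * alphaS c J μ := by
    rw [Nat.mul_sub, mul_comm (μ.factorial) N]
    exact Nat.sub_add_cancel (Nat.mul_le_mul_left _ hα)
  have hαe := alphaS_le he
  rcases hαe.eq_or_lt with heq | hlt
  · have hβe := betaS_le he heq.symm
    rw [← heq]; omega
  · have h1 : alphaS c J μ + 1 ≤ spt₁ μ e := hlt
    have h2 := Nat.mul_le_mul_left N h1
    rw [Nat.mul_add, mul_one] at h2
    omega

include hcy hc1 hc2 hgen hdim hgen' hdim' in
/-- Every point of the weak transform has `spt₁′ + L ≥ αs`. [cite: CossartJannsenSaito2020, Lemma 12.4 (4)] -/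
theorem alphaS_le_spt₁_colon_curve_add (hne : (pts c J μ).Nonempty)
    (hδ : μ.factorial < deltaS c J μ) (hα : μ.factorial ≤ alphaS c J μ) {e' : Fin (r + 2) →₀ ℕ}
    (he' : e' ∈ pts c' ((J.map φ).colon {φ (c (u1 r)) ^ μ}) μ) : alphaS c J μ ≤ spt₁ μ e' + μ.factorial := by
  by_contra hlt
  push Not at hlt
  set N := betaS c J μ + spt₂ μ e' + 1 with hN
  have h := lowerBound_pts_colon_curve φ hcy hc1 hc2 hgen hdim hgen' hdim' hne hδ hα (N := N)
    (by omega) e' he'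
  have h1 : spt₁ μ e' + 1 ≤ alphaS c J μ - μ.factorial := by omega
  have h2 : N * (spt₁ μ e' + 1) ≤ N * (alphaS c J μ - μ.factorial) := Nat.mul_le_mul_left _ h1
  rw [Nat.mul_add, mul_one] at h2
  omega

include hcy hc1 hc2 hgen hdim hgen' hdim' in
/-- On the line `x₁′ = α − 1` the new ordinates are `≥ β`. [cite: CossartJannsenSaito2020, Lemma 12.4 (4)] -/
theorem betaS_le_spt₂_colon_curve (hne : (pts c J μ).Nonempty) (hδ : μ.factorial < deltaS c J μ)
    (hα : μ.factorial ≤ alphaS c J μ) {e' : Fin (r + 2) →₀ ℕ} (he' : e' ∈ pts c' ((J.map φ).colon {φ (c (u1 r)) ^ μ}) μ)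
    (h1 : spt₁ μ e' + μ.factorial = alphaS c J μ) : betaS c J μ ≤ spt₂ μ e' := by
  have h := lowerBound_pts_colon_curve φ hcy hc1 hc2 hgen hdim hgen' hdim' hne hδ hα le_rfl e' he'
  have : spt₁ μ e' = alphaS c J μ - μ.factorial := by omega
  rw [this] at h
  omega

include hcy hc1 hc2 hgen hdim hgen' hdim' in
/-- **Realisation of the vertex `v`** (curve chart): `v = (α, β)` goes up to `(α − 1, β)`
(`J ⊆ (y, u₁)^μ`, `L < δs`, `L ≤ αs`). [cite: CossartJannsenSaito2020, Lemma 12.4 (4)] -/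
theorem exists_pts_colon_curve_v (hJμ : J ≤ yu1Ideal c ^ μ)
    (hne : (pts c J μ).Nonempty) (hδ : μ.factorial < deltaS c J μ)
    (hα : μ.factorial ≤ alphaS c J μ) :
    ∃ e' ∈ pts c' ((J.map φ).colon {φ (c (u1 r)) ^ μ}) μ, spt₁ μ e' + μ.factorial = alphaS c J μ ∧ spt₂ μ e' = betaS c J μ := by
  obtain ⟨e, he, h1, h2⟩ := exists_pts_v hne
  set N := betaS c J μ + 1 with hN
  have hmin : ∀ x ∈ pts c J μ, N * spt₁ μ e + 1 * spt₂ μ e ≤ N * spt₁ μ x + 1 * spt₂ μ x := by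
    have key := isMinOn_lex (S := pts c J μ) (ℓ₁ := spt₁ μ) (ℓ₂ := spt₂ μ) (e := e)
      (fun x hx => by rw [h1]; exact alphaS_le hx)
      (fun x hx hx1 => by rw [h2]; exact betaS_le hx (by rw [hx1, h1]))
    intro x hx
    have := key x hx
    rw [h2] at this ⊢
    rw [hN]; omega
  have hℓ : N * spt₁ μ e + 1 * spt₂ μ e = N * alphaS c J μ + betaS c J μ := by
    rw [← h1, ← h2]; ring
  have hposv : 0 < N * (alphaS c J μ - μ.factorial) + betaS c J μ := by
    have hd := deltaS_le_alphaS_add_betaS hne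
    rcases hα.eq_or_lt with hαeq | hαlt
    · rw [← hαeq, Nat.sub_self, mul_zero, zero_add]; omega
    · have h1' : 1 ≤ alphaS c J μ - μ.factorial := by omega
      have : 1 * 1 ≤ N * (alphaS c J μ - μ.factorial) := Nat.mul_le_mul (by omega) h1'
      omega
  have hkey : N * (alphaS c J μ - μ.factorial) + μ.factorial * N = N * alphaS c J μ := by
    rw [Nat.mul_sub, mul_comm (μ.factorial) N]
    exact Nat.sub_add_cancel (Nat.mul_le_mul_left _ hα)
  have hpos : 0 < N * spt₁ μ e + 1 * spt₂ μ e := by rw [hℓ]; omega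
  obtain ⟨f, hf, hinit⟩ := exists_isInitialTerm_levelWeight_of_isMinOn c hgen hdim (by omega)
    Nat.one_pos he hmin hpos
  have hsub : μ.factorial * N ≤ N * spt₁ μ e + 1 * spt₂ μ e := by rw [hℓ]; omega
  set w₀' := N * spt₁ μ e + 1 * spt₂ μ e - μ.factorial * N with hw₀'
  have hwt : levelWeight (r := r) μ (N * spt₁ μ e + 1 * spt₂ μ e) N 1 =
      curvePullbackWeight (levelWeight μ w₀' N 1) := by
    rw [← levelWeight_eq_curvePullbackWeight, Nat.sub_add_cancel hsub]
  rw [hwt] at hinit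
  have hW' : ∀ i : Fin (r + 2), 0 < levelWeight μ w₀' N 1 i := by
    refine levelWeight_pos ?_ (by omega) Nat.one_pos
    rw [hw₀', hℓ]; omega
  refine ⟨curvePt μ e, curvePt_mem_pts φ hcy hc1 hc2 _ hgen hdim hgen' hdim' hW' hJμ hf he.2 hinit,
    ?_, ?_⟩
  · have hdeg : μ ≤ ydeg e + e (u1 r) := by
      -- `spt₁ e = αs ≥ L`, i.e. `e₁ · sfac ≥ (μ − e₀) · sfac`
      have h3 : (μ - ydeg e) * sfac μ e ≤ e (u1 r) * sfac μ e := by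
        rw [sub_mul_sfac he.2]; rw [← h1, spt₁] at hα; exact hα
      have := Nat.le_of_mul_le_mul_right h3 (sfac_pos he.2)
      omega
    have := spt₁_curvePt_add he.2 hdeg
    omega
  · rw [spt₂_curvePt, h2]

include hcy hc1 hc2 hgen hdim hgen' hdim' in
/-- The weak transform has points of `y`-degree `< μ`. [cite: CossartJannsenSaito2020, Lemma 12.4 (4)] -/
theorem pts_colon_curve_nonempty (hJμ : J ≤ yu1Ideal c ^ μ)
    (hne : (pts c J μ).Nonempty) (hδ : μ.factorial < deltaS c J μ)
    (hα : μ.factorial ≤ alphaS c J μ) : (pts c' ((J.map φ).colon {φ (c (u1 r)) ^ μ}) μ).Nonempty := by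
  obtain ⟨e', he', -⟩ := exists_pts_colon_curve_v φ hcy hc1 hc2 hgen hdim hgen' hdim' hJμ hne hδ hα
  exact ⟨e', he'⟩

include hcy hc1 hc2 hgen hdim hgen' hdim' in
/-- **CJS Lemma 12.4 (4) / CoP1 Lemma 4.5 (1): `α′ = α − 1`** (scaled: `αs′ + L = αs`).
[cite: CossartJannsenSaito2020, Lemma 12.4 (4)] [cite: CossartPiltant2008, Lemma 4.5 (1)] -/
theorem alphaS_colon_curve_add (hJμ : J ≤ yu1Ideal c ^ μ)
    (hne : (pts c J μ).Nonempty) (hδ : μ.factorial < deltaS c J μ)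
    (hα : μ.factorial ≤ alphaS c J μ) : alphaS c' ((J.map φ).colon {φ (c (u1 r)) ^ μ}) μ + μ.factorial = alphaS c J μ := by
  have hne' := pts_colon_curve_nonempty φ hcy hc1 hc2 hgen hdim hgen' hdim' hJμ hne hδ hα
  obtain ⟨e', he', he1, -⟩ := exists_pts_colon_curve_v φ hcy hc1 hc2 hgen hdim hgen' hdim' hJμ hne hδ hα
  refine le_antisymm ?_ ?_
  · have := alphaS_le he'; omega
  · obtain ⟨a, ha, ha1⟩ := exists_pts_alphaS hne'
    have := alphaS_le_spt₁_colon_curve_add φ hcy hc1 hc2 hgen hdim hgen' hdim' hne hδ hα ha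
    omega

include hcy hc1 hc2 hgen hdim hgen' hdim' in
/-- **CJS Lemma 12.4 (4) / CoP1 Lemma 4.5 (1): `β′ = β`.**
[cite: CossartJannsenSaito2020, Lemma 12.4 (4)] [cite: CossartPiltant2008, Lemma 4.5 (1)] -/
theorem betaS_colon_curve_eq (hJμ : J ≤ yu1Ideal c ^ μ)
    (hne : (pts c J μ).Nonempty) (hδ : μ.factorial < deltaS c J μ)
    (hα : μ.factorial ≤ alphaS c J μ) : betaS c' ((J.map φ).colon {φ (c (u1 r)) ^ μ}) μ = betaS c J μ := by
  have hαeq := alphaS_colon_curve_add φ hcy hc1 hc2 hgen hdim hgen' hdim' hJμ hne hδ hα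
  obtain ⟨e', he', he1, he2⟩ := exists_pts_colon_curve_v φ hcy hc1 hc2 hgen hdim hgen' hdim' hJμ hne hδ hα
  have hne' : (pts c' ((J.map φ).colon {φ (c (u1 r)) ^ μ}) μ).Nonempty := ⟨e', he'⟩
  refine le_antisymm ?_ ?_
  · rw [← he2]; exact betaS_le he' (by omega)
  · obtain ⟨b, hb, hb1, hb2⟩ := exists_pts_v hne'
    rw [← hb2]
    exact betaS_le_spt₂_colon_curve φ hcy hc1 hc2 hgen hdim hgen' hdim' hne hδ hα hb (by omega)

/-! ### The lowest vertex under the curve chart: `ε′ = ε`, `ζ′ = ζ − 1` -/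

include hcy hc1 hc2 hgen hdim hgen' hdim' in
/-- **Realisation of `(ζ, ε)`** (curve chart): the lowest vertex goes up to `(ζ − 1, ε)`.
[cite: CossartJannsenSaito2020, Lemma 12.4 (4)] -/
theorem exists_pts_colon_curve_zeta (hJμ : J ≤ yu1Ideal c ^ μ)
    (hne : (pts c J μ).Nonempty) (hδ : μ.factorial < deltaS c J μ)
    (hα : μ.factorial ≤ alphaS c J μ) :
    ∃ e' ∈ pts c' ((J.map φ).colon {φ (c (u1 r)) ^ μ}) μ, spt₂ μ e' = epsS c J μ ∧ spt₁ μ e' + μ.factorial = zetaS c J μ := by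
  obtain ⟨e, he, h2, h1⟩ := exists_pts_zeta hne
  set N := zetaS c J μ + 2 with hN
  have hmin : ∀ x ∈ pts c J μ, 1 * spt₁ μ e + N * spt₂ μ e ≤ 1 * spt₁ μ x + N * spt₂ μ x := by
    have key := isMinOn_lex (S := pts c J μ) (ℓ₁ := spt₂ μ) (ℓ₂ := spt₁ μ) (e := e)
      (fun x hx => by rw [h2]; exact epsS_le hx)
      (fun x hx hx2 => by rw [h1]; exact zetaS_le hx (by rw [hx2, h2]))
    intro x hx
    have hkx := key x hx
    rw [h1] at hkx ⊢
    have hex : epsS c J μ ≤ spt₂ μ x := epsS_le hx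
    rw [← h2] at hex
    have hsplit : ∀ t : ℕ, N * t = (zetaS c J μ + 1) * t + t := by intro t; rw [hN]; ring
    rw [hsplit, hsplit]
    omega
  have hℓ : 1 * spt₁ μ e + N * spt₂ μ e = zetaS c J μ + N * epsS c J μ := by rw [← h1, ← h2]; ring
  have hδζ := deltaS_le_zetaS_add_epsS hne
  have hNε : epsS c J μ ≤ N * epsS c J μ := Nat.le_mul_of_pos_left _ (by omega)
  have hLℓ : μ.factorial < 1 * spt₁ μ e + N * spt₂ μ e := by rw [hℓ]; omega
  obtain ⟨f, hf, hinit⟩ := exists_isInitialTerm_levelWeight_of_isMinOn c hgen hdim Nat.one_pos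
    (by omega) he hmin (by omega)
  set w₀' := 1 * spt₁ μ e + N * spt₂ μ e - μ.factorial * 1 with hw₀'
  have hwt : levelWeight (r := r) μ (1 * spt₁ μ e + N * spt₂ μ e) 1 N =
      curvePullbackWeight (levelWeight μ w₀' 1 N) := by
    rw [← levelWeight_eq_curvePullbackWeight, Nat.sub_add_cancel (by omega)]
  rw [hwt] at hinit
  have hW' : ∀ i : Fin (r + 2), 0 < levelWeight μ w₀' 1 N i := levelWeight_pos (by omega) Nat.one_pos (by omega)
  refine ⟨curvePt μ e, curvePt_mem_pts φ hcy hc1 hc2 _ hgen hdim hgen' hdim' hW' hJμ hf he.2 hinit,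
    ?_, ?_⟩
  · rw [spt₂_curvePt, h2]
  · have hαζ := alphaS_le_zetaS hne
    have hdeg : μ ≤ ydeg e + e (u1 r) := by
      have h3 : (μ - ydeg e) * sfac μ e ≤ e (u1 r) * sfac μ e := by
        rw [sub_mul_sfac he.2]
        have : μ.factorial ≤ spt₁ μ e := by rw [h1]; omega
        rwa [spt₁] at this
      have := Nat.le_of_mul_le_mul_right h3 (sfac_pos he.2)
      omega
    have := spt₁_curvePt_add he.2 hdeg
    omega

include hcy hc1 hc2 hgen hdim hgen' hdim' in
/-- Lower bound `ε′ ≥ ε` (curve chart; `εs > 0`). [cite: CossartJannsenSaito2020, Lemma 12.4 (4)] -/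
theorem epsS_le_spt₂_colon_curve (hα : μ.factorial ≤ alphaS c J μ) {e' : Fin (r + 2) →₀ ℕ}
    (he' : e' ∈ pts c' ((J.map φ).colon {φ (c (u1 r)) ^ μ}) μ) :
    epsS c J μ ≤ spt₂ μ e' := by
  rcases Nat.eq_zero_or_pos (epsS c J μ) with h0 | hε
  · rw [h0]; exact Nat.zero_le _
  by_contra hlt
  push Not at hlt
  set N := spt₁ μ e' + 1 with hN
  have h := forall_pts_colon_curve_of_forall_pts φ hcy hc1 hc2 hgen hdim hgen' hdim'
    (w₀' := N * epsS c J μ + (alphaS c J μ - μ.factorial)) (p₁' := 1) (p₂' := N)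
    (by have : 1 * 1 ≤ N * epsS c J μ := Nat.mul_le_mul (by omega) hε
        omega) Nat.one_pos (by omega) (fun e he => by
      have ha := alphaS_le he
      have h2 := epsS_le he
      have h3 : N * epsS c J μ ≤ N * spt₂ μ e := Nat.mul_le_mul_left _ h2
      omega) e' he'
  have h3 : N * (spt₂ μ e' + 1) ≤ N * epsS c J μ := Nat.mul_le_mul_left _ hlt
  rw [Nat.mul_add, mul_one] at h3
  omega

include hcy hc1 hc2 hgen hdim hgen' hdim' in
/-- **`ε′ = ε`** (curve chart). [cite: CossartJannsenSaito2020, Lemma 12.4 (4)] -/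
theorem epsS_colon_curve_eq (hJμ : J ≤ yu1Ideal c ^ μ)
    (hne : (pts c J μ).Nonempty) (hδ : μ.factorial < deltaS c J μ)
    (hα : μ.factorial ≤ alphaS c J μ) : epsS c' ((J.map φ).colon {φ (c (u1 r)) ^ μ}) μ = epsS c J μ := by
  obtain ⟨e', he', h2, -⟩ := exists_pts_colon_curve_zeta φ hcy hc1 hc2 hgen hdim hgen' hdim' hJμ hne hδ hα
  have hne' : (pts c' ((J.map φ).colon {φ (c (u1 r)) ^ μ}) μ).Nonempty := ⟨e', he'⟩
  refine le_antisymm ?_ ?_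
  · rw [← h2]; exact epsS_le he'
  · obtain ⟨b, hb, hb2⟩ := exists_pts_epsS hne'
    rw [← hb2]
    exact epsS_le_spt₂_colon_curve φ hcy hc1 hc2 hgen hdim hgen' hdim' hα hb

include hcy hc1 hc2 hgen hdim hgen' hdim' in
/-- **`ζ′ ≤ ζ − 1`** (curve chart; scaled: `ζs′ + L ≤ ζs`). [cite: CossartJannsenSaito2020, Lemma 12.4 (4)] -/
theorem zetaS_colon_curve_add_le (hJμ : J ≤ yu1Ideal c ^ μ)
    (hne : (pts c J μ).Nonempty) (hδ : μ.factorial < deltaS c J μ)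
    (hα : μ.factorial ≤ alphaS c J μ) : zetaS c' ((J.map φ).colon {φ (c (u1 r)) ^ μ}) μ + μ.factorial ≤ zetaS c J μ := by
  obtain ⟨e', he', h2, h1⟩ := exists_pts_colon_curve_zeta φ hcy hc1 hc2 hgen hdim hgen' hdim' hJμ hne hδ hα
  have hε := epsS_colon_curve_eq φ hcy hc1 hc2 hgen hdim hgen' hdim' hJμ hne hδ hα
  have := zetaS_le he' (by rw [h2, hε])
  omega

end Laws

end WeightedOrder

end Literature.AlgebraicGeometry.Resolution

end
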